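import Summits.Parity.GeneralizedHardyLittlewood.Theorems.BeyondDiagonalBeatsQuarter.MellinBumpCoprime
import Summits.Parity.GeneralizedHardyLittlewood.Theorems.BeyondDiagonalBeatsQuarter.MellinBumpWeights
import HarnessLib

/-!
# Route `PrimeLevelFamEdge`, crux K_B (stmt-Parity-20343), line `diagonal_kernel_split` rev 4, plan Ω —
# **C1 for the DIVISOR LAYERS: the Mellin-bump bound with coprimality-restricted mollifier weights and two lengths**
# (input I5c = I5a ∘ I5b of the a8P-closable total)

In the layer `(d₁, d₂)` of the off-diagonal core the pair sum runs over `l = d₁m₁`, `m = d₂m₂` with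
`c_{d_im_i} = [μ(d_i)ψ(d_i)⁻¹d_i^{−1/2}]·𝟙[(m_i,d_i)=1]·μ(m_i)ψ(m_i)⁻¹m_i^{−1/2}(log((M/d_i)/m_i)/log M)²`, i.e. (up to the
`(l m)^{1/2}` absorbed into the window and the constant `(log(M/d_i)/log M)²`) the weight
`w_i(m)·λ_{M/d_i}(m)`, `w_i = 𝟙[(·,d_i)=1]·W`. This file assembles the divisor-layer C1:

* §1 `abs_sum_le_threshold` — the threshold form of a `log`-power decay (the lead's `abs_sum_W_le_threshold` for a
  general weight, constant LINEAR in the input constant);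
* §2 `abs_coprimeW_le_inv`, **`mellinBump_coprime_bv`** — for every `k`, `a₀ > 0` there are `D > 0`, `c ≥ 1` with:
  for all `d₁, d₂ ≥ 1`, windows `a₀ ≤ a ≤ b`, `K ≥ 0`, `K`-Lipschitz `h` supported in `[a,b]` with `|h| ≤ B`,
  `M₁, M₂ > 1`, `Y ≥ 1`:
  `|Σ_{m₁≤M₁}Σ_{m₂≤M₂} (𝟙[(m₁,d₁)=1]W(m₁)λ_{M₁}(m₁))(𝟙[(m₂,d₂)=1]W(m₂)λ_{M₂}(m₂))·h(m₁m₂/Y)|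
     ≤ D·(c^{ω(d₁)} + c^{ω(d₂)})·(2(2B + K(b−a))(1+|log b|) + 4K√(bY)/Y)/(1 + log Y)^k`
  (`MellinBumpWeights.mellinBump_weights_bv` with `η = D(c^{ω(d₁)}+c^{ω(d₂)})/(1+log Y)^{k+1}` from
  `MellinBumpCoprime.abs_sum_coprime_W_le` at exponent `k+1` and §1). For `d₁ = d₂ = 1` this is `mellinBump_xsq_bv`
  up to the constant; the phase/complex/window layers (`mellinBump_xsq_e(_complex)`, `MellinBumpWindows`) transfer
  verbatim since they only use the real C1 bound as a black box — their `d`-versions are the consumer's one-liners.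

Theorems only; standard axioms. Helper toward `stub_offDiagBelowSlack_io`; closes nothing.
«The programme SEARCHES and TYPES; no claim about Landau–Siegel zeros, Theorems 1–2 of arXiv:2211.02515 or
a repaired Margin232 until a kernel theorem says so.»
-/

noncomputable section

open scoped Real ArithmeticFunction.Moebius
open Finset ArithmeticFunction

namespace Summit.Parity.GeneralizedHardyLittlewood.Theorems.BeyondDiagonalBeatsQuarter.MellinBump

open Literature.NumberTheory.LFunctions Literature.NumberTheory.LFunctions.KMV2000
open MollifierMainTerm (W)
open KernelFormXSq

/-! ### §1. Threshold form of a `log`-power decay -/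

/-- **Threshold form.** If `|Σ_{j≤e} w(j)| ≤ C/(1 + log e)^k` for all `e ≥ 1` (`C ≥ 0`), then for `Y ≥ 1` and every
`e ≥ √(aY) − 1`: `|Σ_{j≤e} w(j)| ≤ C·D/(1 + log Y)^k` with `D` depending on `k, a` only (`a > 0`).
(`MellinBump.abs_sum_W_le_threshold` for a general weight.) [folklore] -/
theorem abs_sum_le_threshold (k : ℕ) {a : ℝ} (ha : 0 < a) :
    ∃ D : ℝ, 0 < D ∧ ∀ (w : ℕ → ℝ) (C : ℝ), 0 ≤ C →
      (∀ e : ℕ, 1 ≤ e → |∑ j ∈ Icc 1 e, w j| ≤ C / (1 + Real.log e) ^ k) →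
      ∀ Y : ℝ, 1 ≤ Y → ∀ e : ℕ, Real.sqrt (a * Y) - 1 ≤ (e : ℝ) →
        |∑ j ∈ Icc 1 e, w j| ≤ C * D / (1 + Real.log Y) ^ k := by
  set Y₀ : ℝ := 16 * (1 + a⁻¹ ^ 2) with hY₀
  have hY₀16 : 16 ≤ Y₀ := by rw [hY₀]; nlinarith [sq_nonneg a⁻¹]
  have hLY₀ : 0 ≤ Real.log Y₀ := Real.log_nonneg (by linarith)
  refine ⟨4 ^ k * (1 + Real.log Y₀) ^ k, by positivity, fun w C hC hCb Y hY e he ↦ ?_⟩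
  rw [show C * (4 ^ k * (1 + Real.log Y₀) ^ k) = C * 4 ^ k * (1 + Real.log Y₀) ^ k by ring]
  have hLY : 0 ≤ Real.log Y := Real.log_nonneg hY
  have hpowY : 0 < (1 + Real.log Y) ^ k := by positivity
  rcases Nat.eq_zero_or_pos e with rfl | he1
  · simp only [show Icc 1 0 = ∅ by rfl, Finset.sum_empty, abs_zero]; positivity
  have hA := hCb e he1
  have he0 : (1 : ℝ) ≤ e := by exact_mod_cast he1
  have hle : 0 ≤ Real.log e := Real.log_nonneg he0
  have hone : 1 ≤ (1 + Real.log Y₀) ^ k := one_le_pow₀ (by linarith)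
  by_cases hYY : Y₀ ≤ Y
  · have key : (1 + Real.log Y) / 4 ≤ 1 + Real.log e := by
      have haY : 16 ≤ a * Y := by
        have h1 : a * Y₀ ≤ a * Y := mul_le_mul_of_nonneg_left hYY ha.le
        have h2 : a * Y₀ = 16 * (a + a⁻¹) := by rw [hY₀]; field_simp
        have h3 : 2 ≤ a + a⁻¹ := by
          have h4 : a + a⁻¹ - 2 = (a - 1) ^ 2 / a := by field_simp; ring
          have h5 : 0 ≤ (a - 1) ^ 2 / a := by positivity
          linarith
        nlinarith
      have hs4 : 4 ≤ Real.sqrt (a * Y) := by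
        rw [show (4 : ℝ) = Real.sqrt (4 ^ 2) by rw [Real.sqrt_sq (by norm_num)]]
        exact Real.sqrt_le_sqrt (by norm_num; linarith)
      have he2 : Real.sqrt (a * Y) / 2 ≤ e := by linarith
      have hlog1 : Real.log (Real.sqrt (a * Y) / 2) ≤ Real.log e :=
        Real.log_le_log (by positivity) he2
      have hlog2 : Real.log (Real.sqrt (a * Y) / 2) = (Real.log a + Real.log Y) / 2 - Real.log 2 := by
        rw [Real.log_div (by positivity) (by norm_num), Real.log_sqrt (by positivity),
          Real.log_mul ha.ne' (by linarith)]
      have hlog3 : Real.log 2 < 0.7 := by have := Real.log_two_lt_d9; linarith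
      have hYa : -2 * Real.log a ≤ Real.log Y := by
        have h1 : a⁻¹ ^ 2 ≤ Y := by
          have : a⁻¹ ^ 2 ≤ Y₀ := by rw [hY₀]; nlinarith [sq_nonneg a⁻¹]
          linarith
        have h2 : Real.log (a⁻¹ ^ 2) ≤ Real.log Y := Real.log_le_log (by positivity) h1
        rw [Real.log_pow, Real.log_inv] at h2
        push_cast at h2
        linarith
      linarith
    have hpos4 : 0 < (1 + Real.log Y) / 4 := by positivity
    calc |∑ j ∈ Icc 1 e, w j| ≤ C / (1 + Real.log e) ^ k := hA
      _ ≤ C / ((1 + Real.log Y) / 4) ^ k :=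
          div_le_div_of_nonneg_left hC (by positivity) (pow_le_pow_left₀ hpos4.le key k)
      _ = C * 4 ^ k / (1 + Real.log Y) ^ k := by rw [div_pow]; field_simp
      _ ≤ C * 4 ^ k * (1 + Real.log Y₀) ^ k / (1 + Real.log Y) ^ k :=
          div_le_div_of_nonneg_right (le_mul_of_one_le_right (by positivity) hone) hpowY.le
  · push Not at hYY
    have h1 : (1 + Real.log Y) ^ k ≤ (1 + Real.log Y₀) ^ k :=
      pow_le_pow_left₀ (by positivity) (by linarith [Real.log_le_log (by linarith) hYY.le]) k
    calc |∑ j ∈ Icc 1 e, w j| ≤ C / (1 + Real.log e) ^ k := hA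
      _ ≤ C := div_le_self hC (one_le_pow₀ (by linarith))
      _ = C * 1 * 1 := by ring
      _ ≤ C * 4 ^ k * ((1 + Real.log Y₀) ^ k / (1 + Real.log Y) ^ k) := by
          gcongr
          · exact one_le_pow₀ (by norm_num)
          · rw [le_div_iff₀ hpowY]; linarith
      _ = C * 4 ^ k * (1 + Real.log Y₀) ^ k / (1 + Real.log Y) ^ k := by ring


/-! ### §2. The divisor-layer C1 -/

/-- The restricted weight is at most `1/m`: `|𝟙[(m,d)=1]·W(m)| ≤ 1/m`. [folklore] -/
theorem abs_coprimeW_le_inv (d : ℕ) (m : ℕ) (hm : 1 ≤ m) :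
    |(if m.Coprime d then W m else 0)| ≤ (m : ℝ)⁻¹ := by
  split_ifs
  · exact abs_W_le m
  · rw [abs_zero]; positivity

/-- **C1 for the divisor layers (coprimality-restricted mollifier weights, two lengths).** For every `k` and
`a₀ > 0` there are `D > 0`, `c ≥ 1` such that for all `d₁, d₂ ≥ 1`, `a₀ ≤ a ≤ b`, `K ≥ 0`, every `K`-Lipschitz `h`
supported in `[a,b]` with `|h| ≤ B`, all `M₁, M₂ > 1` and `Y ≥ 1`:
`|Σ_{m₁≤⌊M₁⌋} Σ_{m₂≤⌊M₂⌋} (𝟙[(m₁,d₁)=1]W(m₁)λ_{M₁}(m₁))·(𝟙[(m₂,d₂)=1]W(m₂)λ_{M₂}(m₂))·h(m₁m₂/Y)|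
   ≤ D·(c^{ω(d₁)} + c^{ω(d₂)})·(2(2B + K(b−a))(1+|log b|) + 4K√(bY)/Y)/(1 + log Y)^k`.
[cite: KowalskiMichelVanderKam2000, Prop. 5.1 p. 18 — derivation; MontgomeryVaughan2007, §8.1 (8.6)] -/
theorem mellinBump_coprime_bv (k : ℕ) {a₀ : ℝ} (ha₀ : 0 < a₀) :
    ∃ D c : ℝ, 0 < D ∧ 1 ≤ c ∧ ∀ (d₁ d₂ : ℕ), 1 ≤ d₁ → 1 ≤ d₂ → ∀ a b K B : ℝ, a₀ ≤ a → a ≤ b → 0 ≤ K →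
      ∀ h : ℝ → ℝ, (∀ x y, |h x - h y| ≤ K * |x - y|) →
      (∀ y, h y ≠ 0 → a ≤ y ∧ y ≤ b) → (∀ y, |h y| ≤ B) →
      ∀ M₁ M₂ : ℝ, 1 < M₁ → 1 < M₂ → ∀ Y : ℝ, 1 ≤ Y →
        |∑ m₁ ∈ Icc 1 ⌊M₁⌋₊, ∑ m₂ ∈ Icc 1 ⌊M₂⌋₊,
            ((if m₁.Coprime d₁ then W m₁ else 0) * logWeight M₁ m₁) *
              ((if m₂.Coprime d₂ then W m₂ else 0) * logWeight M₂ m₂) * h ((m₁ : ℝ) * m₂ / Y)| ≤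
          D * (c ^ d₁.primeFactors.card + c ^ d₂.primeFactors.card) *
            (2 * ((2 * B + K * (b - a)) * (1 + |Real.log b|)) + 4 * K * (Real.sqrt (b * Y) / Y)) /
              (1 + Real.log Y) ^ k := by
  obtain ⟨C, c, hC, hc, hCb⟩ := abs_sum_coprime_W_le (k + 1)
  obtain ⟨D, hD, hthr⟩ := abs_sum_le_threshold (k + 1) ha₀
  refine ⟨C * D, c, by positivity, hc, ?_⟩
  intro d₁ d₂ hd₁ hd₂ a b K B ha hab hK h hLip hsupp hBh M₁ M₂ hM₁ hM₂ Y hY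
  have hY0 : 0 < Y := by linarith
  have hLY : 0 ≤ Real.log Y := Real.log_nonneg hY
  set L : ℝ := 1 + Real.log Y with hL
  have hL1 : 1 ≤ L := by rw [hL]; linarith
  have hc0 : 0 ≤ c := by linarith
  -- partial sums of the two restricted weights beyond the threshold
  set η : ℝ := C * (c ^ d₁.primeFactors.card + c ^ d₂.primeFactors.card) * D / L ^ (k + 1) with hη
  have hη0 : 0 ≤ η := by positivity
  have hthr' : ∀ (d : ℕ), 1 ≤ d → ∀ e : ℕ, Real.sqrt (a * Y) - 1 ≤ (e : ℝ) →
      |∑ j ∈ Icc 1 e, (if j.Coprime d then W j else 0)| ≤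
        C * c ^ d.primeFactors.card * D / L ^ (k + 1) := by
    intro d hd e he
    have h1 := hthr (fun j ↦ if j.Coprime d then W j else 0) (C * c ^ d.primeFactors.card) (by positivity)
      (hCb d hd) Y hY e ?_
    · simpa [hL, mul_assoc] using h1
    · -- the threshold at `a` dominates the threshold at `a₀`
      have : Real.sqrt (a₀ * Y) ≤ Real.sqrt (a * Y) :=
        Real.sqrt_le_sqrt (mul_le_mul_of_nonneg_right ha hY0.le)
      linarith
  have hA₁ : ∀ e : ℕ, Real.sqrt (a * Y) - 1 ≤ (e : ℝ) →
      |∑ j ∈ Icc 1 e, (if j.Coprime d₁ then W j else 0)| ≤ η := by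
    intro e he
    refine (hthr' d₁ hd₁ e he).trans ?_
    rw [hη]
    gcongr
    have : 0 ≤ c ^ d₂.primeFactors.card := by positivity
    linarith
  have hA₂ : ∀ e : ℕ, Real.sqrt (a * Y) - 1 ≤ (e : ℝ) →
      |∑ j ∈ Icc 1 e, (if j.Coprime d₂ then W j else 0)| ≤ η := by
    intro e he
    refine (hthr' d₂ hd₂ e he).trans ?_
    rw [hη]
    gcongr
    have : 0 ≤ c ^ d₁.primeFactors.card := by positivity
    linarith
  have ha0 : 0 < a := lt_of_lt_of_le ha₀ ha
  have hmain := mellinBump_weights_bv (abs_coprimeW_le_inv d₁) (abs_coprimeW_le_inv d₂) ha0 hab hK hLip hsupp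
    hBh hM₁ hM₂ hY hη0 hA₁ hA₂
  refine hmain.trans ?_
  -- `η·(X·L + Z) ≤ (C D (c^ω₁ + c^ω₂))·(X + Z)/L^k`
  have hB0 : 0 ≤ B := (abs_nonneg _).trans (hBh 0)
  have hX0 : 0 ≤ 2 * ((2 * B + K * (b - a)) * (1 + |Real.log b|)) := by
    have : 0 ≤ K * (b - a) := mul_nonneg hK (by linarith)
    positivity
  have hZ0 : 0 ≤ 4 * K * (Real.sqrt (b * Y) / Y) := by positivity
  have hLk : 0 < L ^ k := by positivity
  rw [hη, hL]
  rw [show 1 + Real.log Y = L from rfl]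
  have key : C * (c ^ d₁.primeFactors.card + c ^ d₂.primeFactors.card) * D / L ^ (k + 1) *
      (2 * ((2 * B + K * (b - a)) * (1 + |Real.log b|) * L) + 4 * K * (Real.sqrt (b * Y) / Y)) =
      C * D * (c ^ d₁.primeFactors.card + c ^ d₂.primeFactors.card) *
        (2 * ((2 * B + K * (b - a)) * (1 + |Real.log b|)) + 4 * K * (Real.sqrt (b * Y) / Y) / L) / L ^ k := by
    rw [pow_succ]
    field_simp
  rw [key]
  gcongr
  exact div_le_self hZ0 hL1

end Summit.Parity.GeneralizedHardyLittlewood.Theorems.BeyondDiagonalBeatsQuarter.MellinBump
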